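import Mathlib.AlgebraicGeometry.Morphisms.Proper
import Mathlib.AlgebraicGeometry.FunctionField
import Mathlib.RingTheory.Kaehler.Basic
import Mathlib.RingTheory.RingHom.Finite
import Mathlib.RingTheory.RingHom.Flat
import Mathlib.Algebra.CharP.Frobenius
import Mathlib.Topology.KrullDimension
import Literature.AlgebraicGeometry.Resolution.ResolutionOfSingularities
import HarnessLib

/-!
# Giraud's normal form of a function on a regular surface of positive characteristic (Giraud 1983)

Topic: `Literature/AlgebraicGeometry/Resolution`. J. Giraud, *Forme normale d'une fonction sur une
surface de caractéristique positive*, Bull. Soc. Math. France 111 (1983) 109–124 [Giraud1983].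
In characteristic `p > 0` the condition "`f = 0` is a normal crossings divisor" says almost
nothing about the zero set `E(f)` of `df` (the restriction of `f` to the regular part of a
component of `E(f)` is a `p`-th power); Giraud proposes the stronger condition (**) (Déf. 1.2:
`E(f)` is a normal crossings divisor AND the log-Jacobian ideal `J(X, f, E(f))` is the ideal of a
normal crossings divisor), characterises it pointwise (Prop. 1.5), and proves that on a REGULAR
SCHEME OF DIMENSION 2 whose sheaf of absolute differentials `Ω¹_X` is locally free of finite rank
(1.1: "ce qui signifie que le morphisme de Frobenius est fini et plat de rang `p^n`") it can be
reached by finitely many blow-ups of closed points (Thm. 2.4).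

This file states, as DEFINITIONS and one NAMED FACT (no proof is attempted — fifteen pages of
surface geometry: the bidual lengths `c(I, ξ)` of 2.1, their drop under point blow-up (Lemmas
2.1.1, 2.3), embedded resolution of the curve `E(df)`):

* `IsDifferentiallyFree y` — Giraud 1.1 "différentiellement libre" at a point: for a local ring
  `O` with residue field `κ`, the differentials `1 ⊗ d(y i)` are `κ`-linearly independent in the
  fibre `κ ⊗_O Ω_{O/ℤ}` of the module of ABSOLUTE Kähler differentials (Giraud: "le module
  `Σ 𝒪_X dx_i` est localement facteur direct de `Ω¹_X`"; for `Ω¹` free of finite rank the two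
  agree by Nakayama — the `dy_i` are part of a basis).
* `Giraud15NormalFormAt p f` — the pointwise normal form of **Prop. 1.5 (ii)**: "il existe un
  voisinage ouvert affine `X' = Spec(R)` du point `ξ`, des éléments `g, x_1, …, x_r, u` de `R` et
  des entiers naturels `a(1), …, a(r)` tels que, dans `R`, on ait `f = g^p + x^a u` avec (a)
  `x_1, …, x_r` est une partie d'un système régulier de paramètres au point `ξ`; (b) `a(i) ≥ 2`;
  (c) (c-1) `a ≢ 0 mod p` et `u` est une unité, ou (c-2) `x_1, …, x_r, u` sont différentiellement
  libres" — rendered in the local ring `O = 𝒪_{X,ξ}` (a consequence of the affine-neighbourhood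
  form), with "part of a regular system of parameters" = the first `r` members of a family
  `t : Fin d → O` generating `𝔪` with `d = dim O`.
* `Giraud1983Thm24` — NAMED FACT, **Thm. 2.4 with Prop. 1.5 (i) ⇒ (ii)**: "Soit `X` un schéma
  régulier de caractéristique `p > 0` et de dimension 2 tel que `Ω¹_X` soit de rang fini et soit
  `f ∈ 𝒪_X(X)` qui n'est pas une puissance `p`-ième. Il existe un morphisme `u : X' → X`, obtenu
  par une suite d'éclatements de points fermés, tel que `f u` satisfasse (**) en tout point de
  `X'`." Users take `(h : Giraud1983Thm24)`.

## Rendering choices (what is weaker / stronger than print, deliberately)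

* The standing hypothesis 1.1 is taken in Giraud's second form, FROBENIUS FINITE AND FLAT on every
  local ring (for the schemes of the applications — regular, locally of finite type over an
  `F`-finite field — finiteness is Kunz's F-finiteness and flatness is Kunz's theorem
  `Kunz1969_holds`, both in the tree), rather than through a sheaf `Ω¹_X` (Mathlib has no sheaf of
  differentials of a scheme).
* `X` is taken integral and quasi-compact (Giraud's termination argument "pour `n` assez grand"
  is on a Noetherian scheme; "`f` n'est pas une puissance `p`-ième" is read in the function
  field, which for a normal integral `X` is the same as in `𝒪_X(X)`).
* The conclusion "obtenu par une suite d'éclatements de points fermés" is flattened to its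
  standard consequences, which is all the applications use and avoids transporting dependent
  blow-up towers: `π : X' → X` proper, `X'` integral and regular (1.1: "notre hypothèse est stable
  par … éclatement de centre régulier"), and `π` an isomorphism over the complement of finitely
  many closed points. `-- TODO(general form): conclusion as a `CentreSeq X` (BlowupSequences.lean)
  whose centres are vanishing ideals of finite sets of closed points.`
* (**) itself (Déf. 1.2, via the log-Jacobian ideal) is not defined here; the fact concludes with
  its pointwise characterisation Prop. 1.5 (ii) (`Giraud15NormalFormAt`) at every point of `X'`,
  which is what Giraud proves ((i) ⇒ (ii), p. 113) and what consumers need. The boundary-adapted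
  variants `KummerNormalFormAt` / `GiraudNormalFormAt` of `KummerNormalForm.lean` are STRONGER at
  the points of case (c-2) with `u` a non-unit (e.g. `f = x²y`, `p ≠ 2`: in Giraud's form with
  `r = 1`, not in Kummer form along `E(f) = {x = 0}`); they are reached from Giraud's by further
  blow-ups and are not asserted here.

Consumers: route `ResolutionOfSingularities/RadicialJung`, crux `CleanModels` (line `Sketch`
rev 10: the dimension-2, `F`-finite case of log-clean models), and the sibling crux
`PicoverLocalModel` of route `PAlteration` in dimension 2.
-/

noncomputable section

open CategoryTheory AlgebraicGeometry TopologicalSpace IsLocalRing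
open scoped TensorProduct

universe u

namespace Literature.AlgebraicGeometry.Resolution

/-- **Differentially free family at a point** (Giraud 1983, 1.1: "une suite `(x_1, …, x_m)`
d'éléments de `𝒪_X(X)` est différentiellement libre si le module `Σ 𝒪_X dx_i` est localement
facteur direct de `Ω¹_X`", absolute differentials `Ω¹_X = Ω¹_{X/𝔽_p} = Ω¹_{X/ℤ}`): for a local
ring `O` with residue field `κ`, the family `y` is differentially free (at the closed point) iff
the elements `1 ⊗ d(y i)` of the fibre `κ ⊗_O Ω_{O/ℤ}` are `κ`-linearly independent; when
`Ω_{O/ℤ}` is free of finite rank (Giraud's standing hypothesis) this says that the `d(y i)` are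
part of a basis (Nakayama), i.e. Giraud's condition at the point.
[cite: Giraud1983, 1.1] -/
def IsDifferentiallyFree {O : Type u} [CommRing O] [IsLocalRing O] {ι : Type} (y : ι → O) :
    Prop :=
  LinearIndependent (ResidueField O)
    (fun i => ((1 : ResidueField O) ⊗ₜ[O] (KaehlerDifferential.D ℤ O (y i)) :
      ResidueField O ⊗[O] (Ω[O⁄ℤ])))

/-- The empty family is differentially free (sanity check of the definition). [folklore] -/
theorem isDifferentiallyFree_of_isEmpty {O : Type u} [CommRing O] [IsLocalRing O] {ι : Type}
    [IsEmpty ι] (y : ι → O) : IsDifferentiallyFree y :=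
  linearIndependent_empty_type

/-- **Giraud's normal form of a function at a point** (Giraud 1983, Prop. 1.5 (ii), read in the
local ring `O = 𝒪_{X,ξ}`): `f = g^p + u · ∏_{i<r} x_i^{a_i}` where `x_i = t_i` (`i < r`) are the
first `r` members of a family `(t_1, …, t_d)` generating the maximal ideal with `d = dim O` — "une
partie d'un système régulier de paramètres" —, every `a_i ≥ 2`, and either (c-1) `a ≢ 0 (mod p)`
(some `a_i` is prime to `p`) and `u` is a unit, or (c-2) `(x_1, …, x_r, u)` is differentially
free (`IsDifferentiallyFree`). [cite: Giraud1983, Prop. 1.5 (ii)] -/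
def Giraud15NormalFormAt (p : ℕ) {O : Type u} [CommRing O] [IsLocalRing O] (f : O) : Prop :=
  ∃ (d r : ℕ) (hrd : r ≤ d) (t : Fin d → O) (g u : O) (a : Fin r → ℕ),
    Ideal.span (Set.range t) = maximalIdeal O ∧ ringKrullDim O = (d : WithBot ℕ∞) ∧
    (∀ i, 2 ≤ a i) ∧ f = g ^ p + u * ∏ i : Fin r, t (Fin.castLE hrd i) ^ a i ∧
    (((∃ i, ¬ p ∣ a i) ∧ IsUnit u) ∨
      IsDifferentiallyFree (Fin.snoc (fun i : Fin r => t (Fin.castLE hrd i)) u))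

/-- A regular parameter `t₀` completed to a minimal generating system is in Giraud normal form with
`r = 0`, `g = 0`, `u = f`, provided `1 ⊗ du ≠ 0` — recorded in the simplest instance: in any local
ring, `f` is in Giraud normal form as soon as some family `t : Fin d → O` generates `𝔪` with
`d = dim O` and the one-member family `(f)` is differentially free (case (c-2), `r = 0`).
[folklore] -/
theorem giraud15NormalFormAt_of_isDifferentiallyFree {p : ℕ} (hp : p ≠ 0) {O : Type u}
    [CommRing O] [IsLocalRing O] {d : ℕ} (t : Fin d → O)
    (ht : Ideal.span (Set.range t) = maximalIdeal O) (hd : ringKrullDim O = (d : WithBot ℕ∞))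
    (f : O)
    (hf : IsDifferentiallyFree (Fin.snoc (fun i : Fin 0 => t (Fin.castLE (Nat.zero_le d) i)) f)) :
    Giraud15NormalFormAt p f :=
  ⟨d, 0, Nat.zero_le d, t, 0, f, Fin.elim0, ht, hd, fun i => i.elim0, by
    rw [zero_pow hp, zero_add, Finset.univ_eq_empty, Finset.prod_empty, mul_one], Or.inr hf⟩

/-- NAMED FACT — **Giraud 1983, Thm. 2.4 (with Prop. 1.5 (i) ⇒ (ii))**: "Soit `X` un schéma
régulier de caractéristique `p > 0` et de dimension `2` tel que `Ω¹_X` soit de rang fini et soit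
`f ∈ 𝒪_X(X)` qui n'est pas une puissance `p`-ième. Il existe un morphisme `u : X' → X`, obtenu
par une suite d'éclatements de points fermés, tel que `f u` satisfasse (**) en tout point de
`X'`" — and (**) in a neighbourhood of a point is equivalent to the normal form of Prop. 1.5 (ii)
there. Rendering (module docstring): `X` an integral quasi-compact regular scheme of dimension `2`
and characteristic `p` whose local rings have finite and flat Frobenius (Giraud 1.1); `f` a global
function which is not a `p`-th power in `K(X)`; conclusion: some proper `π : X' → X` with `X'`
integral and regular, an isomorphism over the complement of finitely many closed points of `X`
(a finite sequence of closed-point blow-ups), such that the pull-back of `f` is in Giraud normal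
form (`Giraud15NormalFormAt`) at EVERY point of `X'`. Users take `(h : Giraud1983Thm24)`.
`-- TODO(general form): the conclusion as a sequence of closed-point blow-ups (CentreSeq).`
[cite: Giraud1983, Thm. 2.4 and Prop. 1.5] -/
def Giraud1983Thm24 : Prop :=
  ∀ (p : ℕ) [Fact p.Prime] (X : Scheme.{0}) [IsIntegral X] [CompactSpace X]
    [CharP Γ(X, ⊤) p],
    Scheme.IsRegular X → topologicalKrullDim X = 2 →
    (∀ (x : X) [CharP (X.presheaf.stalk x) p],
      (frobenius (X.presheaf.stalk x) p).Finite ∧ (frobenius (X.presheaf.stalk x) p).Flat) →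
    ∀ f : Γ(X, ⊤), (∀ c : X.functionField, c ^ p ≠ (X.presheaf.germ ⊤ (genericPoint X) trivial) f) →
    ∃ (X' : Scheme.{0}) (π : X' ⟶ X), IsProper π ∧ IsIntegral X' ∧ Scheme.IsRegular X' ∧
      (∃ U : X.Opens, ((U : Set X)ᶜ).Finite ∧ (∀ x ∈ (U : Set X)ᶜ, IsClosed ({x} : Set X)) ∧
        IsIso (π ∣_ U)) ∧
      ∀ x' : X', Giraud15NormalFormAt p ((X'.presheaf.germ ⊤ x' trivial) (π.appTop f))

end Literature.AlgebraicGeometry.Resolution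

end
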